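import Literature.AlgebraicGeometry.Motives.HodgeStructureCentralizerGeneratedByLefschetzGroup
import HarnessLib

/-!
# REMARK 1.6 LITERALLY: `C'(A) ≅ C(A) ⊗_k k'` AS AN ISOMORPHISM OF `K`-ALGEBRAS — for every field `K ⊇ ℚ` the `K`-points
# `C(H)(K) ⊆ End_K(K ⊗_ℚ V)` of Milne's centralizer are CANONICALLY the base change `K ⊗_ℚ C(H)`: `k ⊗ γ ↦ k · γ_K` is an
# isomorphism of `K`-algebras `K ⊗_ℚ C(H) ≃ₐ[K] C(H)(K)` compatible with the involutions, unique, and `dim_K C(H)(K) = dim_ℚ C(H)`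
# (Milne 1999 §1 Remark 1.6)

[topic AlgebraicGeometry/Motives]

Layer `Literature/AlgebraicGeometry/Motives`, lane `lit-hodgefound` (Track 2 foundations library; prover seat
`lit-hodgefound-p02`, generation 53, self-proposed row g53-#5). THEOREMS ONLY: no definition, no named fact (net debt `0`),
no instance, no notation.  Sequel, BY NAME (nothing restated), of p34's `K`-points files: Milne's `C(A) ⊗_k K` is read in the tree
as `C(H)(K) = Subalgebra.centralizer K ((· ⊗ K) '' E_φ) ⊆ End_K(K ⊗_ℚ V)` (`Motives/HodgeStructureLefschetzGroupPoints`), and Remark 1.6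
was landed in SPAN form — `C(H)(K)` has underlying `K`-submodule the `K`-span of the `γ_K`, `γ ∈ C(H)`
(`mem_centralizer_endAlg_baseChange_iff_mem_span`, `Motives/HodgeStructureCentralizerGeneratedByLefschetzGroup`; «centralisers commute
with extension of scalars», `Motives/HodgeGroupCommutativeIffCMPoints`).  Here the remark is made LITERAL: the abstract base change
`K ⊗_ℚ C(H)` (Mathlib's tensor product of algebras) is identified with `C(H)(K)` by the canonical map `k ⊗ γ ↦ k · γ_K`, an
isomorphism of `K`-algebras (injective because `End_K(K ⊗ V) = K ⊗ End_ℚ(V)` is itself a base change — Mathlib's `IsBaseChange.end`,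
Bourbaki's `ω` — and `K` is flat over `ℚ`; surjective by the span form).  The `K`-adjoint is p34's `Polarization.adjointBaseChange`
(`Motives/HodgeStructurePolarizationAdjointPoints`, `(a_K)^{†_K} = (a†)_K`).

## The source, verbatim

J. S. Milne, *Lefschetz classes on abelian varieties*, Duke Math. J. 96 (1999) 639–675 [Milne1999LefschetzClasses] (held
`paper:doi-10-1215-s0012-7094-99-09620-5`), p. 644 L29–L34: "**Remark 1.6.** If `X ↦ H^*(X)` is a Weil cohomology theory with
coefficient field `k`, and `k'` is a field containing `k`, then `X ↦ H^*(X) ⊗_k k'` is a Weil cohomology theory with coefficient field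
`k'`. If `C'(A)` and `S'(A)` denote the objects defined relative to the second theory, then there are canonical isomorphisms
`C'(A) ≅ C(A) ⊗_k k'`, `S'(A) ≅ S(A)_{/k'}`."; p. 644 L17–L18: "`S(A)(R) = {γ ∈ C(A) ⊗_k R | γ†γ = 1}`."  Also N. Bourbaki,
*Algebra I* [BourbakiAlgebraI1989] Ch. II §5 no. 3 Prop. 7 (ii) and formulas (17)–(18) (`Hom` commutes with base change for finite
free modules: `ω(b ⊗ u) = r_b ⊗ u`), P. Deligne [Deligne1982HodgeCycles] I §3 Prop. 3.1 (proof: extension of scalars).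

## Dictionary and what is proved (namespace `Literature.AlgebraicGeometry.Motives.HodgeStructure`)

`C(H) = Subalgebra.centralizer ℚ (H.endAlg : Set (Module.End ℚ V))`,
`C(H)(K) = Subalgebra.centralizer K ((fun a ↦ a.baseChange K) '' (H.endAlg : Set (Module.End ℚ V)))`, `γ_K = γ.baseChange K`,
`K ⊗_ℚ C(H)` = Mathlib's `K ⊗[ℚ] ↥C(H)` with its `K`-algebra structure; `†` = `ψ.adjoint`, `†_K` = `ψ.adjointBaseChange K`.

* §1 `smul_baseChange_mem_centralizer_endAlg_baseChange` (`k · γ_K ∈ C(H)(K)`), `baseChange_linearMap_eq_of_forall_tmul`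
  (UNIQUENESS: a `K`-linear map out of `K ⊗_ℚ C(H)` is determined by the `k ⊗ γ` — «canonical»).
* §2 **`exists_baseChange_centralizer_algEquiv`** (REMARK 1.6: `e : K ⊗_ℚ C(H) ≃ₐ[K] C(H)(K)` with `e (k ⊗ γ) = k · γ_K`),
  **`finrank_centralizer_endAlg_baseChange_eq`** (`dim_K C(H)(K) = dim_ℚ C(H)`), `finite_centralizer_endAlg_baseChange`
  (`C(H)(K)` is finite-dimensional over `K`).
* §3 **`Polarization.coe_map_tmul_adjoint_eq_adjointBaseChange`** (ANY map with `e (k ⊗ γ) = k · γ_K` carries `1 ⊗ †` to `†_K`: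
  `e (k ⊗ γ†) = (e (k ⊗ γ))^{†_K}` — «as `k`-algebras with involution», so that `S'(A) = {γ†γ = 1}` is read off `C'(A)`),
  `Polarization.exists_baseChange_centralizer_algEquiv_adjoint` (packaged).
-/

noncomputable section

open scoped TensorProduct

namespace Literature.AlgebraicGeometry.Motives

namespace HodgeStructure

universe u uK

variable (K : Type uK) [Field K] [Algebra ℚ K] {V : Type u} [AddCommGroup V] [Module ℚ V] {n : ℤ} (H : HodgeStructure V n)

/-! ## §1 `k · γ_K ∈ C(H)(K)`; maps out of `K ⊗_ℚ C(H)` are determined on pure tensors -/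

/-- Mathlib's base-change map of endomorphisms `IsBaseChange.endHom` for `K ⊗_ℚ V` is `a ↦ a_K` (Bourbaki's `ω(b ⊗ u) = r_b ⊗ u`
at `b = 1`; universe-general private copy of the tree's `endHom_isBaseChange_eq_baseChange`, whose `K` lives in the universe of `V`).
[cite: BourbakiAlgebraI1989, Ch. II §5 no. 3, formulas (17)–(18)] -/
private theorem endHom_isBaseChange_eq_baseChange'' (a : Module.End ℚ V) :
    (TensorProduct.isBaseChange ℚ V K).endHom a = a.baseChange K := by
  refine LinearMap.ext fun x => ?_
  induction x using TensorProduct.induction_on with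
  | zero => rw [map_zero, map_zero]
  | add x y hx hy => rw [map_add, map_add, hx, hy]
  | tmul c v =>
    have hcv : c ⊗ₜ[ℚ] v = c • ((1 : K) ⊗ₜ[ℚ] v) := by
      rw [TensorProduct.smul_tmul', smul_eq_mul, mul_one]
    rw [hcv, map_smul, map_smul, LinearMap.baseChange_tmul]
    exact congrArg (c • ·) (IsBaseChange.endHom_comp_apply (TensorProduct.isBaseChange ℚ V K) a v)

/-- **`k · γ_K ∈ C(H)(K)` for `γ ∈ C(H)` and `k ∈ K`** (`γ_K a_K = (γ a)_K = (a γ)_K = a_K γ_K`: base change is multiplicative).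
[cite: Milne1999LefschetzClasses, §1 Remark 1.6 (p. 644)] [cite: BourbakiAlgebraI1989, Ch. II §5 no. 3, formulas (17)–(18)] -/
theorem smul_baseChange_mem_centralizer_endAlg_baseChange (k : K) {γ : Module.End ℚ V}
    (hγ : γ ∈ Subalgebra.centralizer ℚ (H.endAlg : Set (Module.End ℚ V))) :
    k • γ.baseChange K ∈
      Subalgebra.centralizer K ((fun a : Module.End ℚ V => a.baseChange K) '' (H.endAlg : Set (Module.End ℚ V))) := by
  refine Subalgebra.smul_mem _ ?_ k
  rw [Subalgebra.mem_centralizer_iff]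
  rintro _ ⟨a, ha, rfl⟩
  rw [← LinearMap.baseChange_mul, ← LinearMap.baseChange_mul, (Subalgebra.mem_centralizer_iff ℚ).1 hγ a ha]

/-- **«canonical»: a `K`-linear map out of `K ⊗_ℚ C(H)` is determined by its values on the pure tensors `k ⊗ γ`** — two `K`-linear maps
`K ⊗_ℚ C(H) → M` (into a `K`-module with compatible `ℚ`-structure, e.g. `End_K(K ⊗ V)` or `C(H)(K)`) with `e (k ⊗ γ) = e' (k ⊗ γ)`
coincide. [cite: BourbakiAlgebraI1989, Ch. II §5 no. 3 Prop. 7] -/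
theorem baseChange_linearMap_eq_of_forall_tmul {M : Type*} [AddCommMonoid M] [Module K M] [Module ℚ M]
    [IsScalarTower ℚ K M]
    (e e' : K ⊗[ℚ] Subalgebra.centralizer ℚ (H.endAlg : Set (Module.End ℚ V)) →ₗ[K] M)
    (h : ∀ (k : K) (γ : Subalgebra.centralizer ℚ (H.endAlg : Set (Module.End ℚ V))), e (k ⊗ₜ[ℚ] γ) = e' (k ⊗ₜ[ℚ] γ)) :
    e = e' :=
  TensorProduct.AlgebraTensorModule.ext h

/-! ## §2 Remark 1.6: `K ⊗_ℚ C(H) ≃ₐ[K] C(H)(K)`, `k ⊗ γ ↦ k · γ_K` -/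

section Main

variable [Module.Finite ℚ V]

/-- **REMARK 1.6, «`C'(A) ≅ C(A) ⊗_k k'`», AS AN ISOMORPHISM OF `K`-ALGEBRAS**: for every field `K ⊇ ℚ` and every finite-dimensional
`ℚ`-Hodge structure there is an isomorphism of `K`-algebras `e : K ⊗_ℚ C(H) ≃ₐ[K] C(H)(K)` with `e (k ⊗ γ) = k · γ_K` — the canonical
map `K ⊗_ℚ C(H) → End_K(K ⊗_ℚ V)` (Mathlib's `Algebra.TensorProduct.lift` of `K → End_K` and `γ ↦ γ_K`) is INJECTIVE, because it is the
restriction to `K ⊗ C(H) ⊆ K ⊗ End_ℚ(V)` (`K` flat over `ℚ`) of the base-change isomorphism `K ⊗_ℚ End_ℚ(V) ⥲ End_K(K ⊗_ℚ V)`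
(Bourbaki II §5 no. 3 Prop. 7 (ii), Mathlib's `IsBaseChange.end`), and has IMAGE `C(H)(K)`, the `K`-span of the `γ_K` (the tree's span
form of Remark 1.6). [cite: Milne1999LefschetzClasses, §1 Remark 1.6 (p. 644 L29–L34)] [cite: BourbakiAlgebraI1989, Ch. II §5 no. 3 Prop. 7 (ii)]
[cite: Deligne1982HodgeCycles, I §3 Prop. 3.1 (proof: extension of scalars)] -/
theorem exists_baseChange_centralizer_algEquiv :
    ∃ e : K ⊗[ℚ] Subalgebra.centralizer ℚ (H.endAlg : Set (Module.End ℚ V)) ≃ₐ[K]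
        Subalgebra.centralizer K ((fun a : Module.End ℚ V => a.baseChange K) '' (H.endAlg : Set (Module.End ℚ V))),
      ∀ (k : K) (γ : Subalgebra.centralizer ℚ (H.endAlg : Set (Module.End ℚ V))),
        ((e (k ⊗ₜ[ℚ] γ) : Subalgebra.centralizer K ((fun a : Module.End ℚ V => a.baseChange K) ''
            (H.endAlg : Set (Module.End ℚ V)))) : Module.End K (K ⊗[ℚ] V)) =
          k • (γ : Module.End ℚ V).baseChange K := by
  -- the canonical `K`-algebra map `φ : K ⊗ C(H) → End_K(K ⊗ V)`, `k ⊗ γ ↦ k · γ_K`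
  let φ : K ⊗[ℚ] Subalgebra.centralizer ℚ (H.endAlg : Set (Module.End ℚ V)) →ₐ[K] Module.End K (K ⊗[ℚ] V) :=
    Algebra.TensorProduct.lift (Algebra.ofId K (Module.End K (K ⊗[ℚ] V)))
      ((Module.End.baseChangeHom ℚ K V).comp (Subalgebra.centralizer ℚ (H.endAlg : Set (Module.End ℚ V))).val)
      fun k _ => Algebra.commute_algebraMap_left k _
  have hφ : ∀ (k : K) (γ : Subalgebra.centralizer ℚ (H.endAlg : Set (Module.End ℚ V))),
      φ (k ⊗ₜ[ℚ] γ) = k • (γ : Module.End ℚ V).baseChange K := fun k γ => by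
    rw [Algebra.TensorProduct.lift_tmul, Algebra.ofId_apply, ← Algebra.smul_def]
    rfl
  -- its image lies in `C(H)(K)`
  have hmem : ∀ x, φ x ∈
      Subalgebra.centralizer K ((fun a : Module.End ℚ V => a.baseChange K) '' (H.endAlg : Set (Module.End ℚ V))) := fun x => by
    induction x using TensorProduct.induction_on with
    | zero =>
      rw [map_zero]
      exact Subalgebra.zero_mem _
    | tmul k γ =>
      rw [hφ]
      exact smul_baseChange_mem_centralizer_endAlg_baseChange K H k γ.2
    | add x y hx hy =>
      rw [map_add]
      exact Subalgebra.add_mem _ hx hy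
  let φ' : K ⊗[ℚ] Subalgebra.centralizer ℚ (H.endAlg : Set (Module.End ℚ V)) →ₐ[K]
      Subalgebra.centralizer K ((fun a : Module.End ℚ V => a.baseChange K) '' (H.endAlg : Set (Module.End ℚ V))) :=
    φ.codRestrict _ hmem
  -- surjective: `C(H)(K)` is the `K`-span of the `γ_K = φ (1 ⊗ γ)`
  have hsurj : Function.Surjective φ' := fun f => by
    have hf := (mem_centralizer_endAlg_baseChange_iff_mem_span K H (f : Module.End K (K ⊗[ℚ] V))).1 f.2
    have hle : Submodule.span K ((fun c₀ : Module.End ℚ V => c₀.baseChange K) ''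
        (Subalgebra.centralizer ℚ (H.endAlg : Set (Module.End ℚ V)) : Set (Module.End ℚ V))) ≤
          LinearMap.range φ.toLinearMap := by
      refine Submodule.span_le.2 ?_
      rintro _ ⟨c, hc, rfl⟩
      refine ⟨(1 : K) ⊗ₜ[ℚ] (⟨c, hc⟩ : Subalgebra.centralizer ℚ (H.endAlg : Set (Module.End ℚ V))), ?_⟩
      rw [AlgHom.toLinearMap_apply, hφ, one_smul]
    obtain ⟨x, hx⟩ := hle hf
    exact ⟨x, Subtype.ext hx⟩
  -- injective: `φ` is the base-change isomorphism `K ⊗ End_ℚ(V) ⥲ End_K(K ⊗ V)` composed with the injection `K ⊗ C(H) ↪ K ⊗ End_ℚ(V)`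
  haveI : Module.Free ℚ V := Module.Free.of_divisionRing ℚ V
  have jE : IsBaseChange K (TensorProduct.isBaseChange ℚ V K).endHom := (TensorProduct.isBaseChange ℚ V K).end
  have hcomp : φ.toLinearMap = jE.equiv.toLinearMap ∘ₗ
      ((Subalgebra.centralizer ℚ (H.endAlg : Set (Module.End ℚ V))).val.toLinearMap.baseChange K) := by
    refine TensorProduct.AlgebraTensorModule.ext fun k γ => ?_
    rw [AlgHom.toLinearMap_apply, hφ, LinearMap.comp_apply, LinearMap.baseChange_tmul, LinearEquiv.coe_coe,
      IsBaseChange.equiv_tmul, endHom_isBaseChange_eq_baseChange'']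
    rfl
  have hinj : Function.Injective φ := by
    rw [← AlgHom.coe_toLinearMap, hcomp, LinearMap.coe_comp]
    refine jE.equiv.injective.comp ?_
    rw [LinearMap.baseChange_eq_ltensor]
    exact Module.Flat.lTensor_preserves_injective_linearMap _ Subtype.val_injective
  have hinj' : Function.Injective φ' := fun x y h => hinj (congrArg Subtype.val h :)
  exact ⟨AlgEquiv.ofBijective φ' ⟨hinj', hsurj⟩, fun k γ => hφ k γ⟩

/-- **`dim_K C(H)(K) = dim_ℚ C(H)`** (Remark 1.6: `C(H)(K) ≅ K ⊗_ℚ C(H)`). [cite: Milne1999LefschetzClasses, §1 Remark 1.6 (p. 644)]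
[cite: BourbakiAlgebraI1989, Ch. II §5 no. 3 Prop. 7 (ii)] -/
theorem finrank_centralizer_endAlg_baseChange_eq :
    Module.finrank K (Subalgebra.centralizer K ((fun a : Module.End ℚ V => a.baseChange K) '' (H.endAlg : Set (Module.End ℚ V)))) =
      Module.finrank ℚ (Subalgebra.centralizer ℚ (H.endAlg : Set (Module.End ℚ V))) := by
  obtain ⟨e, -⟩ := exists_baseChange_centralizer_algEquiv K H
  haveI : Module.Free ℚ (Subalgebra.centralizer ℚ (H.endAlg : Set (Module.End ℚ V))) := by
    exact Module.Free.of_divisionRing ℚ (Subalgebra.centralizer ℚ (H.endAlg : Set (Module.End ℚ V)))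
  rw [← LinearEquiv.finrank_eq e.toLinearEquiv, Module.finrank_baseChange]

/-- **`C(H)(K)` is finite-dimensional over `K`** (it is `K ⊗_ℚ C(H)` and `C(H) ⊆ End_ℚ(V)` is finite-dimensional).
[cite: Milne1999LefschetzClasses, §1 Remark 1.6 (p. 644)] -/
theorem finite_centralizer_endAlg_baseChange :
    Module.Finite K (Subalgebra.centralizer K ((fun a : Module.End ℚ V => a.baseChange K) '' (H.endAlg : Set (Module.End ℚ V)))) := by
  obtain ⟨e, -⟩ := exists_baseChange_centralizer_algEquiv K H
  haveI : Module.Finite ℚ (Subalgebra.centralizer ℚ (H.endAlg : Set (Module.End ℚ V))) :=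
    Module.Finite.of_injective (Subalgebra.val _).toLinearMap Subtype.val_injective
  exact Module.Finite.equiv e.toLinearEquiv

end Main

/-! ## §3 «as `k`-algebras with involution»: `e (k ⊗ γ†) = (e (k ⊗ γ))^{†_K}` -/

section Involution

variable [Module.Finite ℚ V] {H} (ψ : Polarization H)

/-- **ANY map `e : K ⊗_ℚ C(H) → C(H)(K)` with `e (k ⊗ γ) = k · γ_K` carries the involution `1 ⊗ †` to the `K`-adjoint `†_K`**:
`e (k ⊗ γ†) = k · (γ†)_K = k · (γ_K)^{†_K} = (k · γ_K)^{†_K} = (e (k ⊗ γ))^{†_K}` (p34's `(a†)_K = (a_K)^{†_K}` and `K`-linearity of `†_K`) —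
so `S'(A)(K) = {γ ∈ C'(A) | γ†γ = 1}` is read off the isomorphism of Remark 1.6.
[cite: Milne1999LefschetzClasses, §1 Remark 1.6 (p. 644) with p. 644 L17–L18] [cite: Huybrechts2016K3, §3.3.5 eq. (3.3)] -/
theorem Polarization.coe_map_tmul_adjoint_eq_adjointBaseChange
    (e : K ⊗[ℚ] Subalgebra.centralizer ℚ (H.endAlg : Set (Module.End ℚ V)) →
      Subalgebra.centralizer K ((fun a : Module.End ℚ V => a.baseChange K) '' (H.endAlg : Set (Module.End ℚ V))))
    (he : ∀ (k : K) (γ : Subalgebra.centralizer ℚ (H.endAlg : Set (Module.End ℚ V))),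
      ((e (k ⊗ₜ[ℚ] γ) : Subalgebra.centralizer K ((fun a : Module.End ℚ V => a.baseChange K) ''
          (H.endAlg : Set (Module.End ℚ V)))) : Module.End K (K ⊗[ℚ] V)) = k • (γ : Module.End ℚ V).baseChange K)
    (k : K) (γ : Subalgebra.centralizer ℚ (H.endAlg : Set (Module.End ℚ V))) :
    ((e (k ⊗ₜ[ℚ] ⟨ψ.adjoint γ, ψ.adjoint_mem_centralizer_endAlg γ.2⟩) : Subalgebra.centralizer K
        ((fun a : Module.End ℚ V => a.baseChange K) '' (H.endAlg : Set (Module.End ℚ V)))) : Module.End K (K ⊗[ℚ] V)) =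
      ψ.adjointBaseChange K ((e (k ⊗ₜ[ℚ] γ) : Subalgebra.centralizer K
        ((fun a : Module.End ℚ V => a.baseChange K) '' (H.endAlg : Set (Module.End ℚ V)))) : Module.End K (K ⊗[ℚ] V)) := by
  rw [he, he, Polarization.adjointBaseChange_smul, Polarization.adjointBaseChange_baseChange]

/-- **REMARK 1.6 «as `k`-algebras with involution»**: the isomorphism `e : K ⊗_ℚ C(H) ≃ₐ[K] C(H)(K)`, `e (k ⊗ γ) = k · γ_K`, satisfies
`e (k ⊗ γ†) = (e (k ⊗ γ))^{†_K}` for every polarization `ψ` (`†` its adjoint on `C(H)`, `†_K` its `K`-adjoint on `End_K(K ⊗ V)`).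
[cite: Milne1999LefschetzClasses, §1 Remark 1.6 (p. 644)] [cite: Huybrechts2016K3, §3.3.5 eq. (3.3)] -/
theorem Polarization.exists_baseChange_centralizer_algEquiv_adjoint :
    ∃ e : K ⊗[ℚ] Subalgebra.centralizer ℚ (H.endAlg : Set (Module.End ℚ V)) ≃ₐ[K]
        Subalgebra.centralizer K ((fun a : Module.End ℚ V => a.baseChange K) '' (H.endAlg : Set (Module.End ℚ V))),
      (∀ (k : K) (γ : Subalgebra.centralizer ℚ (H.endAlg : Set (Module.End ℚ V))),
        ((e (k ⊗ₜ[ℚ] γ) : Subalgebra.centralizer K ((fun a : Module.End ℚ V => a.baseChange K) ''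
            (H.endAlg : Set (Module.End ℚ V)))) : Module.End K (K ⊗[ℚ] V)) =
          k • (γ : Module.End ℚ V).baseChange K) ∧
      ∀ (k : K) (γ : Subalgebra.centralizer ℚ (H.endAlg : Set (Module.End ℚ V))),
        ((e (k ⊗ₜ[ℚ] ⟨ψ.adjoint γ, ψ.adjoint_mem_centralizer_endAlg γ.2⟩) : Subalgebra.centralizer K
            ((fun a : Module.End ℚ V => a.baseChange K) '' (H.endAlg : Set (Module.End ℚ V)))) : Module.End K (K ⊗[ℚ] V)) =
          ψ.adjointBaseChange K ((e (k ⊗ₜ[ℚ] γ) : Subalgebra.centralizer K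
            ((fun a : Module.End ℚ V => a.baseChange K) '' (H.endAlg : Set (Module.End ℚ V)))) : Module.End K (K ⊗[ℚ] V)) := by
  obtain ⟨e, he⟩ := exists_baseChange_centralizer_algEquiv K H
  exact ⟨e, he, fun k γ => ψ.coe_map_tmul_adjoint_eq_adjointBaseChange K e he k γ⟩

end Involution

end HodgeStructure

end Literature.AlgebraicGeometry.Motives
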